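import Mathlib.Algebra.Homology.Embedding.CochainComplex
import Literature.Algebra.Homology.StaircaseComplexes
import HarnessLib

/-!
# Vanishing of the staircase terms past the staircase, and boundedness of the `ℤ`-extension

Continuation of `Algebra/Homology/StaircaseComplexes`. If the exponent function vanishes at `j`
(`e j = 0`: "past the staircase", `j ≥ r` for `e j = (r - j) N`), the `j`-th term of the staircase
quotient `K / q^{e}` is zero (`isZero_powQuotient_X`: a cokernel of `q⁰ = 1`), and so is every
staircase image inside a zero term (`isZero_powImage_X`). Consequently such complexes are
concentrated in degrees `[0, r-1]`; for hypercohomology one uses their extension by zero to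
`ℤ`-indexed complexes (Mathlib's `HomologicalComplex.extend` along `ComplexShape.embeddingUpNat`),
which is then strictly supported in `[0, r-1]` (`isStrictlyLE_extend_of_isZero`,
`isStrictlyGE_extend`), the input of vanishing statements such as the tree's
`Crystalline.sheafHypercohomology_eq_zero` (`ℍⁿ = 0` for `n > (r-1) + d`). [folklore]
Everything is proved; no named facts.
-/

noncomputable section

namespace Literature.Algebra.Homology

open CategoryTheory CategoryTheory.Limits

universe v u

variable {𝒜 : Type u} [Category.{v} 𝒜] [Abelian 𝒜]

/-- If `e j = 0` then multiplication by `q ^ e j` is the identity. [folklore] -/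
theorem powSMul_eq_id (K : CochainComplex 𝒜 ℕ) (q : ℤ) {e : ℕ → ℕ} {j : ℕ} (hj : e j = 0) :
    powSMul K q e j = 𝟙 (K.X j) := by
  rw [powSMul, hj, pow_zero, one_smul]

/-- **Past the staircase the quotient vanishes**: if `e j = 0` then `(K / q^{e})ʲ = Kʲ / q⁰ Kʲ = 0`.
[folklore] -/
theorem isZero_powQuotient_X (K : CochainComplex 𝒜 ℕ) (q : ℤ) {e : ℕ → ℕ} (he : Antitone e)
    {j : ℕ} (hj : e j = 0) : IsZero ((powQuotient K q he).X j) := by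
  haveI : Epi (powSMul K q e j) := by rw [powSMul_eq_id K q hj]; infer_instance
  exact isZero_cokernel_of_epi (powSMul K q e j)

/-- For the staircase `e j = (r - j) N`, the quotient vanishes in degrees `j ≥ r`. [folklore] -/
theorem isZero_powQuotient_X_of_le (K : CochainComplex 𝒜 ℕ) (q : ℤ) {r N : ℕ}
    (he : Antitone fun j : ℕ ↦ (r - j) * N) {j : ℕ} (hj : r ≤ j) :
    IsZero ((powQuotient K q he).X j) :=
  isZero_powQuotient_X K q he (by rw [Nat.sub_eq_zero_of_le hj, zero_mul])

/-- A staircase image inside a zero term is zero. [folklore] -/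
theorem isZero_powImage_X (Q : CochainComplex 𝒜 ℕ) (q : ℤ) {e : ℕ → ℕ} (he : Antitone e) {j : ℕ}
    (hj : IsZero (Q.X j)) : IsZero ((powImage Q q he).X j) :=
  (isZero_zero 𝒜).of_iso (imageZero' (hj.eq_of_src (powSMul Q q e j) 0))

/-! ### The extension by zero to `ℤ` is strictly bounded -/

/-- The extension by zero of an `ℕ`-indexed cochain complex to `ℤ` is strictly concentrated in
degrees `≥ 0` (Mathlib instance, restated). [folklore] -/
theorem isStrictlyGE_extend [HasZeroObject 𝒜] (L : CochainComplex 𝒜 ℕ) :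
    CochainComplex.IsStrictlyGE (L.extend ComplexShape.embeddingUpNat) 0 := inferInstance

/-- **If `Lʲ = 0` for all `j ≥ r` then the extension by zero of `L` to `ℤ` is strictly concentrated
in degrees `≤ r - 1`.** [folklore] -/
theorem isStrictlyLE_extend_of_isZero [HasZeroObject 𝒜] (L : CochainComplex 𝒜 ℕ) (r : ℕ)
    (hL : ∀ j : ℕ, r ≤ j → IsZero (L.X j)) :
    CochainComplex.IsStrictlyLE (L.extend ComplexShape.embeddingUpNat) ((r : ℤ) - 1) := by
  rw [CochainComplex.isStrictlyLE_iff]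
  intro i hi
  obtain ⟨j, rfl⟩ := Int.eq_ofNat_of_zero_le (show (0 : ℤ) ≤ i by lia)
  exact (hL j (by exact_mod_cast (show (r : ℤ) ≤ j by lia))).of_iso
    (L.extendXIso ComplexShape.embeddingUpNat (i := j) (by simp))

/-- For the staircase `e j = (r - j) N`: every staircase image of the quotient `K / q^{(r-•)N}`,
extended by zero to `ℤ`, is strictly concentrated in degrees `[0, r-1]` (so its hypercohomology on
a site of cohomological dimension `≤ d` vanishes above `(r-1) + d`). [folklore] -/
theorem isStrictlyLE_extend_powImage_powQuotient [HasZeroObject 𝒜] (K : CochainComplex 𝒜 ℕ)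
    (q : ℤ) {r N : ℕ} (hc : Antitone fun j : ℕ ↦ (r - j) * N) {e : ℕ → ℕ} (he : Antitone e) :
    CochainComplex.IsStrictlyLE
      ((powImage (powQuotient K q hc) q he).extend ComplexShape.embeddingUpNat) ((r : ℤ) - 1) :=
  isStrictlyLE_extend_of_isZero _ r fun _ hj ↦
    isZero_powImage_X _ q he (isZero_powQuotient_X_of_le K q hc hj)

end Literature.Algebra.Homology

end
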